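import Mathlib
import HarnessLib
import Literature.Analysis.FluidPDE.PressureDecayEstimate
import Literature.Analysis.FluidPDE.RusinSverakBackwardRegularity
import Summits.NavierStokesRegularity.NavierStokesRegularity.Theorems.LocalVelCompTubeDoorLocalPointZoomVelSlices
import Summits.NavierStokesRegularity.NavierStokesRegularity.Theorems.StableStrataDoorZoomFrameAlong
import Summits.NavierStokesRegularity.NavierStokesRegularity.Theorems.StableStrataDoorOneSliceDefs

/-!
# StableStrataDoorAlongTimesSing — SEED-26 input **I1a `LocalPointZoomAlongTimesSing` PROVED** (singular-apex form of the
# prescribed-time zoom; door S26 «StableStrataDoor», nsreg-p1 g21 ADDENDUM-25A v5; text = `StableStrataDoorOneSliceDefs.LocalPointZoomAlongTimesSing`)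

`localPointZoomAlongTimesSing_holds : LocalPointZoomAlongTimesSing`: at a space–time locally Type-I, non-backward-bounded point
`(x₀, T)` of a classical Leray–Hopf flow and along ANY sequence of times `tₙ → T⁻`, a subsequence of the parabolic zooms at the
PRESCRIBED scales `λ² = ν(T − tₙ)` converges pointwise on every slice to a door-class profile that is BACKWARD-SINGULAR at the apex
(persistence of singularities along the prescribed scales).  Corollary of the prescribed-time frame
`StableStrataDoorZoomFrameAlong.localTreeZoomFrameAlong` run with the trivial floor `κ = 0` (its singular apex comes from
`Seregin2020.exists_ancientLimit_along` + `exists_profile_repr`), and of the generic slice-convergence lemma `zoomSlices_tendsto`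
(the lineage's `σ = √(−s)` rescaling of `localPointZoomVelSlices` + `localZoomFrame_tendsto`, here isolated for reuse).

WHAT THIS IS NOT: not NS regularity (Clay A); a compactness input (I1a; with I1b `SingularProfileFloor` it would re-derive I1) of
sequential ε-criteria INSIDE the Type-I class; no route, no item.
-/

noncomputable section

set_option linter.dupNamespace false

namespace Summit.NavierStokesRegularity.NavierStokesRegularity.Theorems.StableStrataDoorAlongTimesSing

open MeasureTheory Set Function Filter Topology TopologicalSpace Metric
open Literature.Analysis Literature.Analysis.FluidPDE Literature.Analysis.FluidPDE.SereginSverak2009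
open Summit.NavierStokesRegularity.NavierStokesRegularity.Theorems
open Summit.NavierStokesRegularity.NavierStokesRegularity.Theorems.LocalSineTubeDoorLocalPointZoomFrame
open Summit.NavierStokesRegularity.NavierStokesRegularity.Theorems.LocalSineTubeDoorLocalPointZoomSlices
open Summit.NavierStokesRegularity.NavierStokesRegularity.Theorems.LocalVelCompTubeDoorLocalPointZoomVel
open Summit.NavierStokesRegularity.NavierStokesRegularity.Theorems.StableStrataDoorZoomFrameAlong
open Summit.NavierStokesRegularity.NavierStokesRegularity.Theorems.StableStrataDoorOneSliceDefs
open Summit.NavierStokesRegularity.NavierStokesRegularity.Theorems.ZoomReturnDoorDefs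
open scoped NNReal ENNReal

/-- **Pointwise convergence of the zoomed velocities on EVERY slice** from the tree zoom frame data (the lineage's `σ = √(−s)`
rescaling: the frame rescaled by `σ` is again a frame, and `localZoomFrame_tendsto` gives its convergence at time `−1`). -/
theorem zoomSlices_tendsto {ν T : ℝ} (hν : 0 < ν) (hT : 0 < T)
    {u : ℝ → EuclideanSpace ℝ (Fin 3) → EuclideanSpace ℝ (Fin 3)}
    (hcont : ContinuousOn (uncurry u) (Ico 0 T ×ˢ univ)) {x₀ : EuclideanSpace ℝ (Fin 3)} {ρ M : ℝ} (hρ : 0 < ρ)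
    (hM : ∀ t ∈ Ico 0 T, T - ρ ^ 2 < t → ∀ x ∈ ball x₀ ρ, ‖u t x‖ * Real.sqrt (ν * (T - t)) ≤ M)
    {R C₁ : ℝ} (hR : 0 < R) {v' : ℝ → EuclideanSpace ℝ (Fin 3) → EuclideanSpace ℝ (Fin 3)}
    {π' : ℝ → EuclideanSpace ℝ (Fin 3) → ℝ} (hball1 : IsSuitableWeakSolutionInBall 1 0 v' π')
    {lam : ℕ → ℝ} (hlam : ∀ j, 0 < lam j) (hlam0 : Tendsto lam atTop (𝓝 0)) {Ks : ℝ≥0} {r₁ : ℝ} (hr₁ : 0 < r₁)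
    (hr₁1 : r₁ ≤ 1) (hKs : ∀ r ∈ Ioc (0 : ℝ) r₁, cknD r (0 : ℝ × EuclideanSpace ℝ (Fin 3)) π' ≤ Ks)
    {w v₁ : ℝ → EuclideanSpace ℝ (Fin 3) → EuclideanSpace ℝ (Fin 3)}
    (hL3 : ∀ a : ℝ, 0 < a → Tendsto (fun j => eLpNorm
      (uncurry ((lam j) • stPull ((lam j) ^ 2) (lam j) (0 : ℝ) (0 : EuclideanSpace ℝ (Fin 3)) v') - uncurry w) 3
      (volume.restrict (parabolicCylinder a (0 : ℝ × EuclideanSpace ℝ (Fin 3))))) atTop (𝓝 0))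
    (hae : ∀ᵐ x ∂(volume.restrict (Iio (0 : ℝ) ×ˢ (univ : Set (EuclideanSpace ℝ (Fin 3))))), uncurry w x = uncurry v₁ x)
    (hP : HasTypeITimeDecay C₁ v₁ ∧ ContinuousOn (uncurry v₁) (Iio (0 : ℝ) ×ˢ univ) ∧
        (∀ s t : ℝ, s < t → t < 0 → ∀ x, v₁ t x =
          UnboundedOperators.heatExtension (v₁ s) (t - s) x - oseenDuhamel 1 s v₁ v₁ t x) ∧
        (∀ t < 0, VectorCalculus.IsDivFree (v₁ t)))
    (hpt : ∀ (j : ℕ) (s : ℝ) (y : EuclideanSpace ℝ (Fin 3)),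
      ((lam j) • stPull ((lam j) ^ 2) (lam j) (0 : ℝ) (0 : EuclideanSpace ℝ (Fin 3)) v') s y =
        ((R * (lam j / 2)) / ν) • u (T + (R * (lam j / 2)) ^ 2 * s / ν) (x₀ + (R * (lam j / 2)) • y))
    {s : ℝ} (hs : s < 0) (y : EuclideanSpace ℝ (Fin 3)) :
    Tendsto (fun j => ((R * (lam j / 2)) / ν) • u (T + (R * (lam j / 2)) ^ 2 * s / ν) (x₀ + (R * (lam j / 2)) • y))
      atTop (𝓝 (v₁ s y)) := by
  -- ## the scaling factor `σ = √(−s)`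
  have hns : 0 < -s := neg_pos.2 hs
  set σ : ℝ := Real.sqrt (-s) with hσdef
  have hσ : 0 < σ := Real.sqrt_pos.2 hns
  have hσ2 : σ ^ 2 = -s := Real.sq_sqrt hns.le
  have hσne : σ ≠ 0 := hσ.ne'
  -- ## the rescaled frame
  set lam' : ℕ → ℝ := fun j => σ * lam j with hlam'def
  have hlam' : ∀ j, 0 < lam' j := fun j => mul_pos hσ (hlam j)
  have hlam0' : Tendsto lam' atTop (𝓝 0) := by
    show Tendsto (fun j => σ * lam j) atTop (𝓝 0)
    simpa using hlam0.const_mul σ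
  set w' : ℝ → (EuclideanSpace ℝ (Fin 3)) → (EuclideanSpace ℝ (Fin 3)) := σ • stPull (σ ^ 2) σ (0 : ℝ) (0 : (EuclideanSpace ℝ (Fin 3))) w with hw'def
  set v₁' : ℝ → (EuclideanSpace ℝ (Fin 3)) → (EuclideanSpace ℝ (Fin 3)) := σ • stPull (σ ^ 2) σ (0 : ℝ) (0 : (EuclideanSpace ℝ (Fin 3))) v₁ with hv₁'def
  have hZZ : ∀ j, (lam' j) • stPull ((lam' j) ^ 2) (lam' j) (0 : ℝ) (0 : (EuclideanSpace ℝ (Fin 3))) v' =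
      σ • stPull (σ ^ 2) σ (0 : ℝ) (0 : (EuclideanSpace ℝ (Fin 3)))
        ((lam j) • stPull ((lam j) ^ 2) (lam j) (0 : ℝ) (0 : (EuclideanSpace ℝ (Fin 3))) v') := by
    intro j
    simp only [hlam'def]
    rw [zoom_zoom]
  -- (pt') identification with the zooms of `u` at the scales `R σλⱼ/2`
  have hpt' : ∀ (j : ℕ) (s' : ℝ) (y' : (EuclideanSpace ℝ (Fin 3))),
      ((lam' j) • stPull ((lam' j) ^ 2) (lam' j) (0 : ℝ) (0 : (EuclideanSpace ℝ (Fin 3))) v') s' y' =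
        ((R * (lam' j / 2)) / ν) • u (T + (R * (lam' j / 2)) ^ 2 * s' / ν) (x₀ + (R * (lam' j / 2)) • y') := by
    intro j s' y'
    have h := hpt j (σ ^ 2 * s') (σ • y')
    simp only [smul_stPull_apply, zero_add] at h ⊢
    simp only [hlam'def]
    rw [show (σ * lam j) ^ 2 * s' = lam j ^ 2 * (σ ^ 2 * s') by ring,
      show (σ * lam j) • y' = lam j • σ • y' by rw [smul_smul, mul_comm],
      mul_smul, h, smul_smul, smul_smul,
      show σ * (R * (lam j / 2) / ν) = R * (σ * lam j / 2) / ν by ring,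
      show T + (R * (lam j / 2)) ^ 2 * (σ ^ 2 * s') / ν = T + (R * (σ * lam j / 2)) ^ 2 * s' / ν by ring,
      show R * (lam j / 2) * σ = R * (σ * lam j / 2) by ring]
  -- (L3') local `L³` convergence of the rescaled zooms to `w'`
  have hus : ∀ f g : ℝ → (EuclideanSpace ℝ (Fin 3)) → (EuclideanSpace ℝ (Fin 3)), uncurry (f - g) = uncurry f - uncurry g := fun f g => rfl
  have hL3' : ∀ a : ℝ, 0 < a → Tendsto (fun j => eLpNorm
      (uncurry ((lam' j) • stPull ((lam' j) ^ 2) (lam' j) (0 : ℝ) (0 : (EuclideanSpace ℝ (Fin 3))) v') - uncurry w') 3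
      (volume.restrict (parabolicCylinder a (0 : ℝ × (EuclideanSpace ℝ (Fin 3)))))) atTop (𝓝 0) := by
    intro a ha
    have hdiff : ∀ j, uncurry ((lam' j) • stPull ((lam' j) ^ 2) (lam' j) (0 : ℝ) (0 : (EuclideanSpace ℝ (Fin 3))) v') -
        uncurry w' = uncurry (σ • stPull (σ ^ 2) σ (0 : ℝ) (0 : (EuclideanSpace ℝ (Fin 3)))
          ((lam j) • stPull ((lam j) ^ 2) (lam j) (0 : ℝ) (0 : (EuclideanSpace ℝ (Fin 3))) v' - w)) := by
      intro j
      rw [hZZ j]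
      funext z
      obtain ⟨s', y'⟩ := z
      simp only [hw'def, uncurry_apply_pair, Pi.sub_apply, smul_stPull_apply, smul_sub]
    have hconst : (‖σ‖ₑ * (ENNReal.ofReal ((σ ^ 2 * σ ^ 3)⁻¹)) ^ (1 / (3 : ℝ≥0∞).toReal)) ≠ ⊤ :=
      ENNReal.mul_ne_top enorm_ne_top
        (ENNReal.rpow_ne_top_of_nonneg (one_div_nonneg.2 ENNReal.toReal_nonneg) ENNReal.ofReal_ne_top)
    have key := ENNReal.Tendsto.const_mul (hL3 (a * σ) (mul_pos ha hσ)) (Or.inr hconst)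
    rw [mul_zero] at key
    refine key.congr fun j => ?_
    rw [hdiff j]
    conv_rhs => rw [show a = a * σ / σ by field_simp]
    rw [eLpNorm_uncurry_zoom hσ σ _ (a * σ) three_ne_zero ENNReal.ofNat_ne_top, hus]
  -- (ae') the rescaled limit agrees a.e. with the rescaled profile
  have hslab : stAffine (σ ^ 2) σ (0 : ℝ) (0 : (EuclideanSpace ℝ (Fin 3))) ⁻¹' (Iio (0 : ℝ) ×ˢ (univ : Set (EuclideanSpace ℝ (Fin 3)))) =
      Iio (0 : ℝ) ×ˢ (univ : Set (EuclideanSpace ℝ (Fin 3))) := by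
    ext z
    simp only [mem_preimage, mem_prod, mem_Iio, mem_univ, and_true, stAffine_fst, zero_add]
    exact ⟨fun h => neg_of_mul_neg_right h (pow_pos hσ 2).le,
      fun h => mul_neg_of_pos_of_neg (pow_pos hσ 2) h⟩
  have hae' : ∀ᵐ x ∂(volume.restrict (Iio (0 : ℝ) ×ˢ (univ : Set (EuclideanSpace ℝ (Fin 3))))),
      uncurry w' x = uncurry v₁' x := by
    have h := ae_eq_restrict_comp_stAffine (f := uncurry w) (g := uncurry v₁) (pow_pos hσ 2) hσ
      (0 : ℝ) (0 : (EuclideanSpace ℝ (Fin 3))) hae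
    rw [hslab] at h
    filter_upwards [h] with z hz
    show σ • uncurry w (stAffine (σ ^ 2) σ (0 : ℝ) (0 : (EuclideanSpace ℝ (Fin 3))) z) =
      σ • uncurry v₁ (stAffine (σ ^ 2) σ (0 : ℝ) (0 : (EuclideanSpace ℝ (Fin 3))) z)
    rw [show uncurry w (stAffine (σ ^ 2) σ (0 : ℝ) (0 : (EuclideanSpace ℝ (Fin 3))) z) =
      uncurry v₁ (stAffine (σ ^ 2) σ (0 : ℝ) (0 : (EuclideanSpace ℝ (Fin 3))) z) from hz]
  -- (P') the rescaled profile is in the class (scaling invariance of rate / continuity / mildness)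
  have hrate' : HasTypeITimeDecay C₁ v₁' := rate_smul_stPull hP.1 hσ
  have hcont' : ContinuousOn (uncurry v₁') (Iio (0 : ℝ) ×ˢ univ) := cont_smul_stPull hP.2.1 hσ
  have hmild' := mild_smul_stPull hP.2.2.1 hσ  -- ## the velocity upgrade at time `−1` of the rescaled frame
  have key := localZoomFrame_tendsto hν hT hcont hρ hM hR hball1 hlam'
    hlam0' hr₁ hr₁1 hKs hpt' hL3' hae' hcont' (σ⁻¹ • y)
  -- ## identification of the terms
  have hZ : ∀ j, ((lam' j) • stPull ((lam' j) ^ 2) (lam' j) (0 : ℝ) (0 : (EuclideanSpace ℝ (Fin 3))) v') (-1)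
      (σ⁻¹ • y) = σ • (((R * (lam j / 2)) / ν) • u (T + (R * (lam j / 2)) ^ 2 * s / ν) (x₀ + (R * (lam j / 2)) • y)) := by
    intro j
    rw [hpt' j (-1) (σ⁻¹ • y)]
    simp only [hlam'def, smul_smul]
    have e2 : T + (R * (σ * lam j / 2)) ^ 2 * (-1) / ν = T + (R * (lam j / 2)) ^ 2 * s / ν := by
      have hs' : s = -σ ^ 2 := by rw [hσ2]; ring
      rw [hs']; ring
    have e3 : R * (σ * lam j / 2) * σ⁻¹ = R * (lam j / 2) := by
      calc R * (σ * lam j / 2) * σ⁻¹ = R * (lam j / 2) * (σ * σ⁻¹) := by ring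
        _ = R * (lam j / 2) := by rw [mul_inv_cancel₀ hσne, mul_one]
    have e4 : R * (σ * lam j / 2) / ν = σ * (R * (lam j / 2) / ν) := by ring
    rw [e2, e3, e4]
  have hlimit : v₁' (-1) (σ⁻¹ • y) = σ • v₁ s y := by
    simp only [hv₁'def, smul_stPull_apply, smul_smul, mul_inv_cancel₀ hσne, one_smul, zero_add]
    rw [show σ ^ 2 * (-1) = s by rw [hσ2]; ring]
  -- ## conclusion: divide by `σ`
  have key' : Tendsto (fun j => σ • (((R * (lam j / 2)) / ν) •
      u (T + (R * (lam j / 2)) ^ 2 * s / ν) (x₀ + (R * (lam j / 2)) • y))) atTop (𝓝 (σ • v₁ s y)) := by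
    rw [← hlimit]
    exact Tendsto.congr hZ key
  have key3 := key'.const_smul σ⁻¹
  simp only [smul_smul, inv_mul_cancel_left₀ hσne, inv_mul_cancel₀ hσne, one_smul] at key3
  exact key3


/-- **I1a · THE LOCAL POINT ZOOM ALONG PRESCRIBED TIMES, singular-apex form** — PROVED (module docstring). -/
theorem localPointZoomAlongTimesSing_holds : LocalPointZoomAlongTimesSing := by
  intro ν hν M T hT u p hcl hLH _ x₀ ρ hρ hM' hnb t htT ht
  -- ## the absolute constants of the pressure decay estimate (frame inputs) and the TRIVIAL floor `κ = 0`
  obtain ⟨c, hPD⟩ := seregin_sverak_pressure_decay_holds.ratio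
  obtain ⟨θ, hθ, hθ2, hcθ⟩ := exists_ratio_mul_le_half c
  have hθ1 : θ < 1 := by linarith
  set Lexpr : ℝ≥0∞ := ENNReal.ofReal ((θ⁻¹) ^ 2) * (1 + 2 * ((c : ℝ≥0∞) * ENNReal.ofReal ((θ⁻¹) ^ 2) *
      ENNReal.ofReal (6 * volume.real (ball (0 : EuclideanSpace ℝ (Fin 3)) 1) * (max M 0 / ν) ^ 3))) with hLexpr
  have hLtop : Lexpr ≠ ∞ :=
    ENNReal.mul_ne_top ENNReal.ofReal_ne_top (ENNReal.add_ne_top.2 ⟨ENNReal.one_ne_top,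
      ENNReal.mul_ne_top (by norm_num) (ENNReal.mul_ne_top (ENNReal.mul_ne_top ENNReal.coe_ne_top
        ENNReal.ofReal_ne_top) ENNReal.ofReal_ne_top)⟩)
  set L : ℝ≥0 := Lexpr.toNNReal with hLdef
  have hL : Lexpr ≤ (L : ℝ≥0∞) := by rw [hLdef, ENNReal.coe_toNNReal hLtop]
  have Hκ : ∀ (Q : Opens (ℝ × EuclideanSpace ℝ (Fin 3)))
      (u : ℝ → EuclideanSpace ℝ (Fin 3) → EuclideanSpace ℝ (Fin 3)) (p : ℝ → EuclideanSpace ℝ (Fin 3) → ℝ)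
      (G : ℝ → EuclideanSpace ℝ (Fin 3) → EuclideanSpace ℝ (Fin 3) →L[ℝ] EuclideanSpace ℝ (Fin 3)),
      IsSuitableWeakSolutionOn Q 1 0 u p → HasWeakSpatialGradientOn Q u G →
      ∀ (z : ℝ × EuclideanSpace ℝ (Fin 3)) (r₀ : ℝ), 0 < r₀ →
        parabolicCylinder r₀ z ⊆ (Q : Set (ℝ × EuclideanSpace ℝ (Fin 3))) →
        cknAEss r₀ z u ≠ ∞ → cknE r₀ z G ≠ ∞ → (∀ r ∈ Ioc (0 : ℝ) r₀, cknD r z p ≤ L) →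
        IsBackwardSingularPoint u z → ∀ r ∈ Ioc (0 : ℝ) r₀, ENNReal.ofReal (0 : ℝ) ≤ cknC r z u :=
    fun _ _ _ _ _ _ _ _ _ _ _ _ _ _ _ _ => by simp
  -- ## the prescribed-time zoom frame
  obtain ⟨R, C₁, v', π', φ, lam, w, v₁, Ks, r₁, hR, hφ, hlam, hlam0, hlam_sq, hball1, hr₁, hr₁1, hKs, hL3, -,
      hae, hP, hsing₁, hpt⟩ :=
    localTreeZoomFrameAlong hν hT hcl hLH hρ hM' hnb htT ht hPD hθ hθ1 hcθ hL Hκ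
  have hM : ∀ t ∈ Ico 0 T, T - ρ ^ 2 < t → ∀ x ∈ ball x₀ ρ, ‖u t x‖ * Real.sqrt (ν * (T - t)) ≤ M := by
    intro t' ht' hlt x hx
    refine le_trans ?_ (hM' t' ht' hlt x hx)
    exact mul_le_mul_of_nonneg_left (le_add_of_nonneg_left (norm_nonneg _)) (norm_nonneg _)
  exact ⟨φ, C₁, v₁, fun j => R * (lam j / 2), hφ, fun j => mul_pos hR (half_pos (hlam j)), hlam_sq, hP, hsing₁,
    fun s hs y => zoomSlices_tendsto hν hT hcl.smooth_velocity.continuousOn hρ hM hR hball1 hlam hlam0 hr₁ hr₁1 hKs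
      hL3 hae hP hpt hs y⟩

end Summit.NavierStokesRegularity.NavierStokesRegularity.Theorems.StableStrataDoorAlongTimesSing

end
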